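import Mathlib
import HarnessLib
import Literature.Computability.AlgebraicComplexity.DivisionSLP
import Literature.LinearAlgebra.Matrix.ShortPlueckerRelation
import Summits.MatrixMultiplication.MatrixMultiplication.Theses.CondensationDistance

/-!
# Crux `CondensationSound` (stmt-MatrixMultiplication-15939) — `Lines/birth.lean`, the BC3 birth skeleton

Route `CondensationDistance` (route-MatrixMultiplication-CondensationDistance; deciding theorem
`closes : ShortCondensation → CondensationSound → DerivationsBoundOmega → MatrixMultiplication`, proved in
the route file).  The crux is the SOUNDNESS bridge of the route (rank 5, difficulty M, "classical but
unvendored"): a valid octahedral Plücker derivation `f : Fin l → Finset (Fin (n + m'))` (every listed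
`n`-set `J = f i` is justified by an octahedron `{J, J−p+u, J−p+v, J−q+u, J−q+v, J−p−q+u+v}` whose other five
vertices lie in the radius-1 ball around `[n]` or are listed earlier) that lists the target set `[n, 2n)`
yields, in the tree's division-SLP model `Derivable` (BCS Def. (4.4)/(4.7), `Literature/…/DivisionSLP.lean`),
a computation of `det X` from the entries of the generic `n × m'` matrix `Z = [X | Y]` over `ℂ(Z)` of length
`≤ 5·l`.

## The line: minors of `Z` as sign-normalised Plücker coordinates, one octahedron = five Ω-steps

Index the maximal minors of the `n × (n + m')` matrix `[I_n | Z]` not by the raw determinant `P_J` (columns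
`J` in increasing order) but by the SIGN-NORMALISED coordinate

  `coord J := det Z[rowsOut J, colsIn J]`,  `rowsOut J = {i < n : i ∉ J}`,  `colsIn J = {j : n + j ∈ J}`

(rows and columns in increasing order; `P_J = ± coord J`, the sign depending on `J` only).  With this
normalisation the radius-1 ball is LITERALLY the input set: `coord [n] = 1` (a free constant of the model)
and `coord ([n] − i + (n+j)) = Z_{ij}` (an entry) — no sign-fixing steps — and the target is literally
`coord [n,2n) = det X` with `X_{ij} = Z_{i, castLE j}` (sign `+1`, as the grounder/refuter notes on the item
demand: "check whether P_{[n,2n)} = +det X under the Fin.castLE column embedding, else the bound is 5l+1").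
One octahedron step is then the three-term Grassmann–Plücker relation, which in the normalised coordinates
reads `coord J · coord J₅ = ε₁ · coord J₁ · coord J₄ + ε₂ · coord J₂ · coord J₃` with `ε₁, ε₂ ∈ {±1}`
(`J₁ … J₅` = the route's list `[J−p+u, J−p+v, J−q+u, J−q+v, J−p−q+u+v]`; the complementary pairings of
`{p,q,u,v}` are `{pq,uv}`, `{pu,qv} = {J₃,J₂}`, `{pv,qu} = {J₄,J₁}`), solved for `coord J` as
`mul, mul, lin-comb (coefficients ε₁, ε₂ — constants are free in `DivStep`), inv (divisor `coord J₅ ≠ 0`, a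
generic minor), mul` = exactly `5` `DivStep`s.  Four registered stubs, all load-bearing in
`CondensationSound_of_stubs`:

* `stub_frame` (S/M, provable now) — the ball values are entries or constants, and the target value is
  `+det X` (reindexing `Fin (colsIn J).card ≃o Fin n`; `Matrix.det_reindex_self`, `Matrix.det_isEmpty`,
  `Matrix.det_unique`).
* `stub_generic_nonvanishing` (M, provable now) — every `coord J`, `|J| = n`, is nonzero in `ℂ(Z)`
  (a minor of a generic matrix is a nonzero polynomial — specialise `Z[R,C]` to a permutation matrix, or
  `Matrix.det_mvPolynomialX_ne_zero` + `MvPolynomial.rename_injective`; `IsFractionRing.injective`).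
* `stub_exchange` (M, provable now; THE ALGEBRA) — the octahedron exchange relation above for `coord`
  (three-term Grassmann–Plücker relation for maximal minors of `[I | Z]`, vendored AS A NAMED FACT
  `Literature.LinearAlgebra.Matrix.FallatJohnson2011_shortPlueckerRelation` — a `Prop`, to be PROVED or
  re-derived, e.g. from `Matrix.det_mul`/Cauchy–Binet-free Laplace expansion `Matrix.det_succ_column`; plus
  the sign bookkeeping `P_J = ± coord J`, `Matrix.det_permute`, `Matrix.det_fromBlocks`-type expansion
  along identity columns).  Stated with `∃ ε₁ ε₂ : ℂ` (in truth `±1`): exactly what one `DivStep`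
  lin-comb consumes, and not weaker in substance (`coord J · coord J₅ ≠ 0`, so a relation must be found).
* `stub_simulation` (M, provable now; THE BOOKKEEPING) — for ANY coordinate system `P` on `n`-sets with the
  three properties (ball ⊆ inputs ∪ constants, nonvanishing, exchange relation), a valid derivation of
  length `l` makes `{P (f i)}` `Derivable` from the entries in `5·l` steps (strong induction on `i`,
  `Derivable.trans`, `Derivable.mul/lin/inv`; the card invariant `|f i| = n` rides along: `J₁ = J−p+u` has
  card `n`, `p ∈ J`, `u ∉ J`).

`CondensationSound_of_stubs : <frame> → <nonvanishing> → <exchange> → <simulation> → CondensationSound` is a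
REAL proof (six lines of logic: instantiate the simulation at `P := coord n m'`, shrink the derived set to
the target value by `Derivable.mono`, rewrite the target by `stub_frame`); `CondensationSound_of :
CondensationSound` feeds it the four declared stubs (the form `ledger skeleton check` registers — it admits
hypotheses only as NAMED obligations, cf. `Cruxes/CheapIdealMember/Lines/birth.lean`, naming note).

Honest status.  Nothing here is open mathematics: the crux is "classical ingredients, new as a package"
(grounder g50-0/g50-1, refuter rreview-0816T16-9: "probably TRUE as typed (M fair); could not break it").
The one place a typed statement could still be wrong is the sign `+1` of the target and the literal
membership of the ball values in the input set — both are isolated in `stub_frame`, whose two clauses were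
hand-checked on the definition (`rowsOut [n,2n) = univ`, `colsIn [n,2n) = {j < n}`, both increasing ⇒
`det (X (a, castLE b))`; ball: `0 × 0` minor `= 1`, `1 × 1` minor `= Z_{pj}`).  No stub is cheaply the crux
or the summit (BC3 probes in `Lines/birth.md`: all eight `stub → CondensationSound` /
`stub → MatrixMultiplication` probes FAIL).
Disproof used: none exists — `ledger crux ls stmt-MatrixMultiplication-15939`: no workfiles before this one
(no `Disproof.lean`, no `Negative/`); `ledger negatives --problem MatrixMultiplication` = 8 entries, all on
STPP designs / S_n subsets / Kronecker-power designs, none on determinant programs or Plücker coordinates.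
-/

set_option linter.dupNamespace false

namespace Summit.MatrixMultiplication.MatrixMultiplication.Cruxes.CondensationSound.Birth

open scoped BigOperators Matrix
open Literature.Computability.AlgebraicComplexity (Derivable)
open Summit.MatrixMultiplication.MatrixMultiplication.Theses.CondensationDistance (CondensationSound)

/-! ## The coordinate system: minors of the generic matrix `Z` indexed by `n`-subsets of `Fin (n + m')` -/

/-- Rows of `Z` that SURVIVE in the minor attached to `J`: the `i < n` whose identity column `e_i`
(index `Fin.castAdd m' i`) is NOT in `J`. [folklore] -/
def rowsOut (n m' : ℕ) (J : Finset (Fin (n + m'))) : Finset (Fin n) :=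
  Finset.univ.filter fun i : Fin n => Fin.castAdd m' i ∉ J

/-- Columns of `Z` selected by `J`: the `j < m'` with `n + j ∈ J` (index `Fin.natAdd n j`). [folklore] -/
def colsIn (n m' : ℕ) (J : Finset (Fin (n + m'))) : Finset (Fin m') :=
  Finset.univ.filter fun j : Fin m' => Fin.natAdd n j ∈ J

/-- The SIGN-NORMALISED Plücker coordinate of `[I_n | Z]` at `J`, as an element of `ℂ(Z)`: the minor
`det Z[rowsOut J, colsIn J]` of the generic matrix `Z = (X_{(i,j)})`, rows and columns in increasing order
(`Finset.orderEmbOfFin`); equals `± P_J` (the maximal minor of `[I | Z]` on the sorted column set `J`) when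
`|J| = n`, which is exactly when `|rowsOut J| = |colsIn J|`; `0` otherwise (never used). [folklore] -/
noncomputable def coord (n m' : ℕ) (J : Finset (Fin (n + m'))) :
    FractionRing (MvPolynomial (Fin n × Fin m') ℂ) :=
  if h : (rowsOut n m' J).card = (colsIn n m' J).card then
    algebraMap (MvPolynomial (Fin n × Fin m') ℂ) (FractionRing (MvPolynomial (Fin n × Fin m') ℂ))
      (Matrix.det (Matrix.of fun a b : Fin (colsIn n m' J).card =>
        (MvPolynomial.X ((rowsOut n m' J).orderEmbOfFin h a, (colsIn n m' J).orderEmbOfFin rfl b) :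
          MvPolynomial (Fin n × Fin m') ℂ)))
  else 0

/-! ## The four registered stubs -/

/-- **STUB 1 — the frame: ball values are inputs, the target value is `+det X`** (S/M, provable now).
(i) If `|J| = n` and `J` has at most one element `≥ n`, then `coord J` is an entry `Z_{ij}` of the generic
matrix (case `rowsOut J = {i}`, `colsIn J = {j}`: a `1 × 1` minor, `Matrix.det_unique`) or the constant `1`
(case `J = [n]`: the `0 × 0` minor, `Matrix.det_isEmpty`); (ii) for `n ≤ m'` the target set
`{x : n ≤ x < 2n}` has `rowsOut = univ`, `colsIn = {j : j < n}`, both enumerated increasingly by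
`orderEmbOfFin`, so `coord` is `det (Z_{a, castLE b})_{a,b}` up to the order-isomorphism
`Fin (colsIn J).card ≃o Fin n` (`Matrix.det_reindex_self` / `Matrix.det_submatrix_equiv_self`).
Leans on: Mathlib `Finset.orderEmbOfFin`, `Finset.card_filter_le_iff`-type card lemmas, `Matrix.det_unique`,
`Matrix.det_isEmpty`, `Matrix.det_reindex_self`.  Sources: BurgisserClausenShokrollahi1997 (Def. (4.4): inputs
and constants of an SLP), Michałek–Sturmfels 2021 Thm 5.4 (minors of `Z` = maximal minors of `[I|Z]`). -/
theorem stub_frame :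
    ∀ n m' : ℕ,
      (∀ J : Finset (Fin (n + m')), J.card = n →
        (J.filter fun x : Fin (n + m') => n ≤ x.val).card ≤ 1 →
          coord n m' J ∈
            (Set.range fun p : Fin n × Fin m' =>
                algebraMap (MvPolynomial (Fin n × Fin m') ℂ) (FractionRing (MvPolynomial (Fin n × Fin m') ℂ))
                  (MvPolynomial.X p)) ∪
              Set.range (algebraMap ℂ (FractionRing (MvPolynomial (Fin n × Fin m') ℂ)))) ∧
      (∀ h : n ≤ m',
        coord n m' (Finset.univ.filter fun x : Fin (n + m') => n ≤ x.val ∧ x.val < 2 * n) =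
          algebraMap (MvPolynomial (Fin n × Fin m') ℂ) (FractionRing (MvPolynomial (Fin n × Fin m') ℂ))
            (Matrix.det (Matrix.of fun i j : Fin n => MvPolynomial.X (i, Fin.castLE h j)))) := by
  sorry

/-- **STUB 2 — generic minors do not vanish** (M, provable now).  For `|J| = n` the coordinate
`coord J = det Z[rowsOut J, colsIn J]` is a nonzero element of `ℂ(Z)`: the minor of a matrix of distinct
indeterminates is a nonzero polynomial (it specialises to `det 1 = 1` under `Z_{r_a, c_b} ↦ δ_{ab}`, or:
it is the image of `det (X_{ab})_{a,b} ≠ 0`, `Matrix.det_mvPolynomialX_ne_zero`, under the injective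
`MvPolynomial.rename` along `(a,b) ↦ (r_a, c_b)`), and `algebraMap ℂ[Z] ℂ(Z)` is injective
(`IsFractionRing.injective`).  These are the divisors of the Plücker steps.  Leans on: Mathlib
`Matrix.det_mvPolynomialX_ne_zero`, `MvPolynomial.rename_injective`, `AlgHom.map_det`/`RingHom.map_det`,
`IsFractionRing.injective`.  Sources: BurgisserClausenShokrollahi1997 (§7.1, generic non-vanishing of
denominators), grounder note g50-0 on the item (fact (3)). -/
theorem stub_generic_nonvanishing :
    ∀ (n m' : ℕ) (J : Finset (Fin (n + m'))), J.card = n → coord n m' J ≠ 0 := by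
  sorry

/-- **STUB 3 — the octahedron exchange relation (three-term Grassmann–Plücker, sign-normalised)** (M,
provable now; the algebraic heart).  For `|J| = n`, `p ≠ q ∈ J`, `u ≠ v ∉ J`, writing
`J₁ = J−p+u`, `J₂ = J−p+v`, `J₃ = J−q+u`, `J₄ = J−q+v`, `J₅ = J−p−q+u+v` (the route's list order):
`coord J · coord J₅ = ε₁ · (coord J₁ · coord J₄) + ε₂ · (coord J₂ · coord J₃)` for some scalars `ε₁, ε₂`
(in truth `ε₁, ε₂ ∈ {1, −1}`, determined by the relative order of `p, q, u, v` and by the signs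
`P_{J'} = σ(J') · coord J'`, `σ(J') = ±1` the shuffle sign of moving the rows `rowsOut J'` of `[I|Z]_{J'}`
to the bottom).  This is the short Plücker relation `[i,i',Δ][j,j',Δ] + [i,j',Δ][i',j,Δ] = [i,j,Δ][i',j',Δ]`
for the maximal minors of `[I_n | Z]ᵀ` with `{i,i',j,j'} = {p,q,u,v}` sorted and `Δ = J ∖ {p,q}`, solved
for the pairing `{pq, uv}` (each of the three pair-products has coefficient `±1`).  Stated with complex
coefficients because that is exactly what ONE `DivStep` linear combination consumes; it is not weaker in
substance (`coord J · coord J₅ ≠ 0` by stub 2, so an honest relation must be produced).  Leans on: the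
named fact `Literature.LinearAlgebra.Matrix.FallatJohnson2011_shortPlueckerRelation` (a `Prop` — to be
proved, or the relation re-derived directly: Laplace expansion `Matrix.det_succ_column_zero`,
multilinearity `Matrix.det_updateCol_add`, `Matrix.det_permute`, `Matrix.det_transpose`), Mathlib
`Matrix.det_fromBlocks_zero₂₁`-type expansion along the identity columns.  Sources: FallatJohnson2011 §1.2,
FominGrigorievKoshevoy2014 (Plücker transformations as algorithm steps), BerensteinFominZelevinsky1996,
OhPostnikovSpeyer2011 §5 (three-term Plücker relations), grounder notes g50-0/g50-1 on the item. -/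
theorem stub_exchange :
    ∀ (n m' : ℕ) (J : Finset (Fin (n + m'))) (p q u v : Fin (n + m')),
      J.card = n → p ∈ J → q ∈ J → p ≠ q → u ∉ J → v ∉ J → u ≠ v →
        ∃ ε₁ ε₂ : ℂ,
          coord n m' J * coord n m' (insert u (insert v ((J.erase p).erase q))) =
            ε₁ • (coord n m' (insert u (J.erase p)) * coord n m' (insert v (J.erase q))) +
              ε₂ • (coord n m' (insert v (J.erase p)) * coord n m' (insert u (J.erase q))) := by
  sorry

/-- **STUB 4 — simulation: valid derivations are division-SLPs, five Ω-steps per octahedron** (M,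
provable now; the bookkeeping, stated for an ARBITRARY coordinate system `P` on subsets of `Fin (n + m')`
with values in `ℂ(Z)`).  If (a) every ball value `P J` (`|J| = n`, at most one element `≥ n`) is an entry
of `Z` or a constant, (b) `P J ≠ 0` for `|J| = n`, and (c) every octahedron satisfies an exchange relation
`P J · P J₅ = ε₁ · P J₁ · P J₄ + ε₂ · P J₂ · P J₃`, then for every VALID derivation `f : Fin l → _` (the
route's validity predicate, verbatim) the set `{P (f i) : i < l}` is `Derivable ℂ (5 * l)` from the entries.
Proof shape: strong induction on `i` carrying the invariant `|f i| = n` (`J₁ = insert u ((f i).erase p)` has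
card `n` — by the ball clause or by induction — and `p ∈ f i`, `u ∉ f i`); at step `i` the five mates are
available (ball ⇒ input or constant; listed earlier ⇒ derived), and
`P (f i) = (ε₁ • (P J₁ * P J₄) + ε₂ • (P J₂ * P J₃)) * (P J₅)⁻¹` is `Derivable.mul`, `.mul`, `.lin`, `.inv`
(`P J₅ ≠ 0` by (b)), `.mul`, chained by `Derivable.trans` (budget `5 i + 5 = 5 (i + 1)`).  Leans on: tree
`Literature.Computability.AlgebraicComplexity.Derivable` API (`Derivable.trans`, `.union`, `.mono`, `.mul`,
`.lin`, `.inv`, `DivSeq.append`), Mathlib `Fin.induction`/`Nat.strong_induction_on`, `Finset.card_insert_of_notMem`,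
`Finset.card_erase_of_mem`.  Sources: BurgisserClausenShokrollahi1997 Def. (4.4)/(4.7), refuter note
rreview-0816T16-9 on the item ("mul, mul, lincomb(±1,±1), inv, mul = exactly 5 steps"), Dodgson1867 /
Bareiss1968 (the monotone instances). -/
theorem stub_simulation :
    ∀ (n m' : ℕ) (P : Finset (Fin (n + m')) → FractionRing (MvPolynomial (Fin n × Fin m') ℂ)),
      (∀ J : Finset (Fin (n + m')), J.card = n →
        (J.filter fun x : Fin (n + m') => n ≤ x.val).card ≤ 1 →
          P J ∈
            (Set.range fun p : Fin n × Fin m' =>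
                algebraMap (MvPolynomial (Fin n × Fin m') ℂ) (FractionRing (MvPolynomial (Fin n × Fin m') ℂ))
                  (MvPolynomial.X p)) ∪
              Set.range (algebraMap ℂ (FractionRing (MvPolynomial (Fin n × Fin m') ℂ)))) →
      (∀ J : Finset (Fin (n + m')), J.card = n → P J ≠ 0) →
      (∀ (J : Finset (Fin (n + m'))) (p q u v : Fin (n + m')),
        J.card = n → p ∈ J → q ∈ J → p ≠ q → u ∉ J → v ∉ J → u ≠ v →
          ∃ ε₁ ε₂ : ℂ,
            P J * P (insert u (insert v ((J.erase p).erase q))) =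
              ε₁ • (P (insert u (J.erase p)) * P (insert v (J.erase q))) +
                ε₂ • (P (insert v (J.erase p)) * P (insert u (J.erase q)))) →
      ∀ (l : ℕ) (f : Fin l → Finset (Fin (n + m'))),
        (∀ i : Fin l, ∃ p ∈ f i, ∃ q ∈ f i, p ≠ q ∧ ∃ u ∉ f i, ∃ v ∉ f i, u ≠ v ∧
          ∀ J ∈ [insert u ((f i).erase p), insert v ((f i).erase p), insert u ((f i).erase q),
            insert v ((f i).erase q), insert u (insert v (((f i).erase p).erase q))],
            (J.card = n ∧ (J.filter fun x : Fin (n + m') => n ≤ x.val).card ≤ 1) ∨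
              ∃ j : Fin l, j < i ∧ f j = J) →
        Derivable ℂ (5 * l)
          (Set.range fun p : Fin n × Fin m' =>
            algebraMap (MvPolynomial (Fin n × Fin m') ℂ) (FractionRing (MvPolynomial (Fin n × Fin m') ℂ))
              (MvPolynomial.X p))
          (Set.range fun i : Fin l => P (f i)) := by
  sorry

/-! ## The composition: the four stub statements prove the crux BY NAME -/

/-- **THE SKELETON THEOREM (explicit-hypothesis form).** The crux
`Summit.MatrixMultiplication.MatrixMultiplication.Theses.CondensationDistance.CondensationSound`
(stmt-MatrixMultiplication-15939) from the four stub STATEMENTS as hypotheses: run the simulation (stub 4)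
on the coordinate system `coord n m'`, whose three prerequisites are stubs 1(i), 2, 3; the derived set
`{coord (f i)}` contains `coord (f i₀) = coord [n,2n) = det X` (stub 1(ii)), and `Derivable` is monotone in
the target (`Derivable.mono`).  Sorry-free; standard axioms. [folklore] -/
theorem CondensationSound_of_stubs
    (hF : ∀ n m' : ℕ,
      (∀ J : Finset (Fin (n + m')), J.card = n →
        (J.filter fun x : Fin (n + m') => n ≤ x.val).card ≤ 1 →
          coord n m' J ∈
            (Set.range fun p : Fin n × Fin m' =>
                algebraMap (MvPolynomial (Fin n × Fin m') ℂ) (FractionRing (MvPolynomial (Fin n × Fin m') ℂ))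
                  (MvPolynomial.X p)) ∪
              Set.range (algebraMap ℂ (FractionRing (MvPolynomial (Fin n × Fin m') ℂ)))) ∧
      (∀ h : n ≤ m',
        coord n m' (Finset.univ.filter fun x : Fin (n + m') => n ≤ x.val ∧ x.val < 2 * n) =
          algebraMap (MvPolynomial (Fin n × Fin m') ℂ) (FractionRing (MvPolynomial (Fin n × Fin m') ℂ))
            (Matrix.det (Matrix.of fun i j : Fin n => MvPolynomial.X (i, Fin.castLE h j)))))
    (hN : ∀ (n m' : ℕ) (J : Finset (Fin (n + m'))), J.card = n → coord n m' J ≠ 0)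
    (hE : ∀ (n m' : ℕ) (J : Finset (Fin (n + m'))) (p q u v : Fin (n + m')),
      J.card = n → p ∈ J → q ∈ J → p ≠ q → u ∉ J → v ∉ J → u ≠ v →
        ∃ ε₁ ε₂ : ℂ,
          coord n m' J * coord n m' (insert u (insert v ((J.erase p).erase q))) =
            ε₁ • (coord n m' (insert u (J.erase p)) * coord n m' (insert v (J.erase q))) +
              ε₂ • (coord n m' (insert v (J.erase p)) * coord n m' (insert u (J.erase q))))
    (hS : ∀ (n m' : ℕ) (P : Finset (Fin (n + m')) → FractionRing (MvPolynomial (Fin n × Fin m') ℂ)),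
      (∀ J : Finset (Fin (n + m')), J.card = n →
        (J.filter fun x : Fin (n + m') => n ≤ x.val).card ≤ 1 →
          P J ∈
            (Set.range fun p : Fin n × Fin m' =>
                algebraMap (MvPolynomial (Fin n × Fin m') ℂ) (FractionRing (MvPolynomial (Fin n × Fin m') ℂ))
                  (MvPolynomial.X p)) ∪
              Set.range (algebraMap ℂ (FractionRing (MvPolynomial (Fin n × Fin m') ℂ)))) →
      (∀ J : Finset (Fin (n + m')), J.card = n → P J ≠ 0) →
      (∀ (J : Finset (Fin (n + m'))) (p q u v : Fin (n + m')),
        J.card = n → p ∈ J → q ∈ J → p ≠ q → u ∉ J → v ∉ J → u ≠ v →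
          ∃ ε₁ ε₂ : ℂ,
            P J * P (insert u (insert v ((J.erase p).erase q))) =
              ε₁ • (P (insert u (J.erase p)) * P (insert v (J.erase q))) +
                ε₂ • (P (insert v (J.erase p)) * P (insert u (J.erase q)))) →
      ∀ (l : ℕ) (f : Fin l → Finset (Fin (n + m'))),
        (∀ i : Fin l, ∃ p ∈ f i, ∃ q ∈ f i, p ≠ q ∧ ∃ u ∉ f i, ∃ v ∉ f i, u ≠ v ∧
          ∀ J ∈ [insert u ((f i).erase p), insert v ((f i).erase p), insert u ((f i).erase q),
            insert v ((f i).erase q), insert u (insert v (((f i).erase p).erase q))],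
            (J.card = n ∧ (J.filter fun x : Fin (n + m') => n ≤ x.val).card ≤ 1) ∨
              ∃ j : Fin l, j < i ∧ f j = J) →
        Derivable ℂ (5 * l)
          (Set.range fun p : Fin n × Fin m' =>
            algebraMap (MvPolynomial (Fin n × Fin m') ℂ) (FractionRing (MvPolynomial (Fin n × Fin m') ℂ))
              (MvPolynomial.X p))
          (Set.range fun i : Fin l => P (f i))) :
    CondensationSound := by
  intro n m' h l f hvalid htgt
  obtain ⟨i₀, hi₀⟩ := htgt
  have hD := hS n m' (coord n m') (hF n m').1 (hN n m') (hE n m') l f hvalid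
  refine hD.mono le_rfl subset_rfl ?_
  intro x hx
  rw [Set.mem_singleton_iff] at hx
  subst hx
  refine ⟨i₀, ?_⟩
  show coord n m' (f i₀) = _
  rw [hi₀]
  exact (hF n m').2 h

/-- **THE SKELETON THEOREM (registered form): the crux BY NAME**, fed with the four DECLARED stubs through
`CondensationSound_of_stubs` (closed only through their `sorry`s; this is the theorem `ledger skeleton check`
registers and the shape the line's provers discharge stub by stub). [folklore] -/
theorem CondensationSound_of : CondensationSound :=
  CondensationSound_of_stubs stub_frame stub_generic_nonvanishing stub_exchange stub_simulation

end Summit.MatrixMultiplication.MatrixMultiplication.Cruxes.CondensationSound.Birth
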